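import Summits.BirchSwinnertonDyer.BirchSwinnertonDyer.Theorems.SignedLowerHalvesKobayashiMainConjectureSmallImageAnalyticTransferRoad
import HarnessLib

/-!
# Route `SignedLowerHalves`, crux `KobayashiMainConjectureSmallImage` (item stmt-BirchSwinnertonDyer-19002):
# the ONE-SIGN SWAP — unit content of Kobayashi's `L^ε_p` crosses the displayed Mazur–Tate congruence in BOTH
# directions, so the E-side one-sign rider supplies the partner's `μ = 0` and the CM-congruence road concludes
# `∃ ε, KobayashiMainConjecture W p ε` with NO partner-side `μ` hypothesis
# (cell `bsd-ssimc`, seat `bsd-line-slh-p3` gen 4; a `--supports stmt-BirchSwinnertonDyer-19002 --as helper` file)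

PARTITION (cell bsd-ssimc): X7 (A7) × item 4's `a_p = 0` window pairs WITH a `p`-congruent CM partner, ALL
ranks — types-the-object-of; the crux stays OPEN (`stub_lowerSmallImage` of line `birth` has no engine and is
BYPASSED here per pair, not proved); closes none; nothing booked; BSD is not proved by any of this. THEOREMS
ONLY: no definition, no named fact, nothing about any curve asserted.

This file is the kernel form of the crux idea card `Cruxes/KobayashiMainConjectureSmallImage/Ideas/cm-anchor-onesign.md`
(bsd-idea-13 g2r; critic VERDICT #9 PASS-WITH-PRICE), «Cheapest falsifier (1)»: its two first-rung `Prop`s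
`CmAnchorOneSign.SwapStatement` and `CmAnchorOneSign.OneSignCmRoad` (sketch sha16 8432f411d41e258f, item
evidence) are PROVED here with their binder lists VERBATIM (§2 `hasUnitContent_of_mazurTate_congr_swap`,
§3 `exists_kobayashiMainConjecture_of_oneSign_of_cmPartner`), so `swapStatement_holds := fun … ↦ §2 …` and
`oneSignCmRoad_holds := fun … ↦ §3 …` are one-liners wherever the sketch is in scope.

## What is proved

* §1 `mazurTate_congr_swap` — the displayed `S₀`-depleted Mazur–Tate congruence
  `hMT : ∀ n, ∃ q r, θ_n(f)·ιP − ι(c)·θ_n(f′)·ιP′ = ι(ω_n q + p r)` with a UNIT `c ∈ ℤ_p` is SYMMETRIC: the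
  same display holds for `(f′, P′, f, P)` with the unit `c⁻¹` (multiply by `−c⁻¹`; pure algebra in `ℚ_p⟦T⟧`).
* §2 `hasUnitContent_of_mazurTate_congr_swap` — hence part 1's `hasUnitContent_and_lam_add_eq_of_mazurTate_congr`
  (direction partner ⇒ `E`) read backwards: for every sign `ε`, unit content of `L^ε_p(E)` gives unit content
  of `L^ε_p(E′)` (and `hasUnitContent_iff_of_mazurTate_congr`: the two are EQUIVALENT under `hMT`, with the
  `λ`-identity `λ(L) + λ(P) = λ(L′) + λ(P′)` whenever either holds).
* §3 `kobayashiMainConjecture_of_oneSign_of_mazurTate_congr_of_cmPartner` /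
  `exists_kobayashiMainConjecture_of_oneSign_of_cmPartner` — the ONE-SIGN CM ROAD: the E-SIDE rider
  `∃ ε₀ L₀, IsSignedPAdicLFunction f₀ p ε₀ L₀ ∧ HasUnitContent L₀` (one of Pollack's `L^±_p(f_E)` has `μ = 0`;
  the output shape of crux idea `onesign-mu-cuspidal-generation`, = hypothesis `hμan₀` of k3-c4x's
  `kobayashiMainConjectureSmallImage_of_lower_of_signedMuAn_oneSign`) REPLACES the partner-side hypothesis
  `hμ′` of part 2's `kobayashiMainConjecture_of_mazurTate_congr_of_cmPartner` (§2 at `ε₀` with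
  `P, P′ = ∏_{S₀} 𝒫_ℓ`, unit content by `hasUnitContent_and_lam_eulerFactorProduct`); conclusion
  `KobayashiMainConjecture W p ε₀`, hence `∃ ε, KobayashiMainConjecture W p ε` — the crux's conclusion shape —
  with NO Eisenstein engine for `E`, NO partner-side `μ` certificate, NO `Surj`, NO rank hypothesis.
  Also §3 `…_of_mainConjecture` (any congruent partner satisfying its own main conjecture, CM or not).

## What then remains (displayed hypotheses, never asserted here)

The published inputs BY NAME (`h12`, `h41` rational clause, `h5`/`h3`, `h09`, `hKim`, `hPR`, `hmod`); per datum
the CM partner `W′` over `ℚ` (good supersingular at `p`, `a_p = 0`, `Γ_ℚ`-iso `W[p] ≃ W′[p]`), the depletion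
set `S₀ ∌ p`, and the congruence `hMT` with a UNIT `c` (the card's want W2cw = canonical ↔ Néron period at
additive level — THE WALL; printed status in part 1's module docstring: Corpuz–Lei 2025 Prop. 4.2 PRE, Vatsal
1999 not held); and the E-side rider (open class-wide: Kurihara–Pollack 2007 §3.2 p. 374, Problem 3.2; per pair
a θ-layer certificate). NOT a class theorem about the crux; closes nothing; BSD is not proved by any of this.

References: [GreenbergVatsal2000] Thm. (1.4), §1 (8)–(9), §3 Rem. 3.4; [Kobayashi2003] Thm. 1.2, Thm. 4.1
(p. 8), (3.4)–(3.6), Conjecture (p. 2); [BDKim2009] Cor. 2.13; [PollackRubin2004] Thm. (p. 448);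
[Pollack2003] Prop. 6.18, Cor. 5.11; [KuriharaPollack2007] §3.2, Problem 3.2; [CorpuzLei2025] Prop. 4.2 (PRE).
Card: `Cruxes/KobayashiMainConjectureSmallImage/Ideas/cm-anchor-onesign.md`; memo `HOME/k3c4-MEMO-7.md`.
-/

set_option autoImplicit false
set_option linter.dupNamespace false
noncomputable section

open scoped Classical MatrixGroups ModularForm BigOperators

open CongruenceSubgroup WeierstrassCurve NumberField IsDedekindDomain
  Literature.NumberTheory.EllipticCurves
  Literature.NumberTheory.EllipticCurves.ModularForms
  Literature.NumberTheory.EllipticCurves.Rank1Residual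
  Literature.NumberTheory.EllipticCurves.Rank1Residual.Typed
  Literature.NumberTheory.EllipticCurves.Kobayashi2003 ZpExtension
  Literature.NumberTheory.EllipticCurves.GreenbergVatsal2000
  Literature.NumberTheory.EllipticCurves.BDKim2009
  Literature.NumberTheory.EllipticCurves.Sprung2017
  Summit.BirchSwinnertonDyer.Rank1Residual.X1.MuLambda
  Summit.BirchSwinnertonDyer.Rank1Residual.X11a
  Summit.BirchSwinnertonDyer.Rank1Residual.Supersingular
  Summit.BirchSwinnertonDyer.BirchSwinnertonDyer.Theorems.SmallImageAnalyticTransfer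
  Summit.BirchSwinnertonDyer.BirchSwinnertonDyer.Theorems.SmallImageAnalyticTransferRoad

namespace Summit.BirchSwinnertonDyer.BirchSwinnertonDyer.Theorems.SmallImageOneSignSwap

variable {p : ℕ} [hp : Fact p.Prime]

/-! ### §1 The displayed Mazur–Tate congruence is symmetric (`c ↦ c⁻¹`) -/

/-- **Pure algebra in `ℚ_p⟦T⟧`: one level of the displayed congruence, swapped.** If
`A·ιP − ι(c)·(B·ιP′) = ι(ω·q + p·r)` and `c′·c = 1` in `ℤ_p`, then
`B·ιP′ − ι(c′)·(A·ιP) = ι(ω·q′ + p·r′)` with `q′ = −c′q`, `r′ = −c′r` (`ι = iwasawaToPowerSeries p`, a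
ring map). Multiply by `−c′`. [folklore] -/
theorem congr_level_swap {A B : PowerSeries ℚ_[p]} {P P' ω q r : IwasawaAlgebra p} {c c' : ℤ_[p]}
    (hcc : c' * c = 1)
    (h : A * iwasawaToPowerSeries p P -
        iwasawaToPowerSeries p (PowerSeries.C c) * (B * iwasawaToPowerSeries p P') =
      iwasawaToPowerSeries p (ω * q + PowerSeries.C (p : ℤ_[p]) * r)) :
    B * iwasawaToPowerSeries p P' -
        iwasawaToPowerSeries p (PowerSeries.C c') * (A * iwasawaToPowerSeries p P) =
      iwasawaToPowerSeries p
        (ω * (-(PowerSeries.C c' * q)) + PowerSeries.C (p : ℤ_[p]) * (-(PowerSeries.C c' * r))) := by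
  have hone : iwasawaToPowerSeries p (PowerSeries.C c') * iwasawaToPowerSeries p (PowerSeries.C c) = 1 := by
    rw [← map_mul, ← map_mul, hcc, map_one, map_one]
  simp only [map_add, map_mul, map_neg] at h ⊢
  linear_combination (-(iwasawaToPowerSeries p (PowerSeries.C c'))) * h +
    (-(B * iwasawaToPowerSeries p P')) * hone

/-- **The displayed `S₀`-depleted Mazur–Tate congruence `hMT` is SYMMETRIC in `(f, P) ↔ (f′, P′)` up to
`c ↦ c⁻¹`.** For any levels `N, N′`, cusp forms `f, f′`, multipliers `P, P′ ∈ Λ` and a unit `c ∈ ℤ_p`: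
`∀ n, ∃ q r, θ_n(f)·ιP − ι(c)·θ_n(f′)·ιP′ = ι(ω_n q + p r)` implies the same display for `(f′, P′, f, P)`
with the unit `↑(u⁻¹)`, `u` the unit of `c` (`congr_level_swap` at every level). This is the algebraic content
of the card's SWAP lever (A): the road's `hMT` can be read in either direction. [folklore] -/
theorem mazurTate_congr_swap {N N' : ℕ} (f : CuspForm (Gamma0 N) 2) (f' : CuspForm (Gamma0 N') 2)
    (P P' : IwasawaAlgebra p) (u : ℤ_[p]ˣ)
    (hMT : ∀ n : ℕ, ∃ q r : IwasawaAlgebra p,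
      ((mazurTateElement f p n).map (algebraMap ℚ ℚ_[p]) : PowerSeries ℚ_[p]) *
            iwasawaToPowerSeries p P -
          iwasawaToPowerSeries p (PowerSeries.C (u : ℤ_[p])) *
            (((mazurTateElement f' p n).map (algebraMap ℚ ℚ_[p]) : PowerSeries ℚ_[p]) *
              iwasawaToPowerSeries p P') =
        iwasawaToPowerSeries p
          (toIwasawa p (cyclotomicOmega p n) * q + PowerSeries.C (p : ℤ_[p]) * r)) :
    ∀ n : ℕ, ∃ q r : IwasawaAlgebra p,
      ((mazurTateElement f' p n).map (algebraMap ℚ ℚ_[p]) : PowerSeries ℚ_[p]) *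
            iwasawaToPowerSeries p P' -
          iwasawaToPowerSeries p (PowerSeries.C ((u⁻¹ : ℤ_[p]ˣ) : ℤ_[p])) *
            (((mazurTateElement f p n).map (algebraMap ℚ ℚ_[p]) : PowerSeries ℚ_[p]) *
              iwasawaToPowerSeries p P) =
        iwasawaToPowerSeries p
          (toIwasawa p (cyclotomicOmega p n) * q + PowerSeries.C (p : ℤ_[p]) * r) := by
  intro n
  obtain ⟨q, r, h⟩ := hMT n
  exact ⟨_, _, congr_level_swap (by simp) h⟩

/-! ### §2 Unit content crosses the congruence in both directions -/

/-- **SWAP LEMMA = the card's `CmAnchorOneSign.SwapStatement`, binders VERBATIM.** Under the displayed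
`S₀`-depleted Mazur–Tate congruence `hMT` with a unit `c` (part 1's shape), for `p` odd, `E = W`, `E′ = W′`
good at `p` with `a_p = 0`, newforms `f, f′` (any levels), unit-content multipliers `P, P′`, and EVERY sign
`ε`: unit content of Kobayashi's `L^ε_p(E)` implies unit content of `L^ε_p(E′)` — part 1's
`hasUnitContent_and_lam_add_eq_of_mazurTate_congr` (direction `E′ ⇒ E`) applied to the SWAPPED display
(`mazurTate_congr_swap`, unit `c⁻¹`) with `μ(L) = 0` (`mu_eq_zero_of_hasUnitContent`). CONDITIONAL on `hMT`;
nothing asserted. [cite: GreenbergVatsal2000, p. 2–3, (1)–(2) and §3 Remark 3.4]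
[cite: Pollack2003, Prop. 6.18 and Cor. 5.11] [cite: Kobayashi2003, Thm. 3.2 and (3.4)–(3.5) (p. 7)] -/
theorem hasUnitContent_of_mazurTate_congr_swap (p : ℕ) [Fact p.Prime]
    (W W' : WeierstrassCurve ℚ) [W.IsElliptic] [W.IsGloballyMinimal] [W'.IsElliptic] [W'.IsGloballyMinimal]
    (hp2 : p ≠ 2) (hgood : W.HasGoodReductionAtPrime p) (hap : W.frobeniusTrace p = 0)
    (hgood' : W'.HasGoodReductionAtPrime p) (hap' : W'.frobeniusTrace p = 0)
    (N N' : ℕ) [NeZero N] [NeZero N'] (f : CuspForm (Gamma0 N) 2) (f' : CuspForm (Gamma0 N') 2)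
    (hf : IsNewformOf W f) (hf' : IsNewformOf W' f')
    (P P' : IwasawaAlgebra p) (hP : HasUnitContent P) (hP' : HasUnitContent P')
    (c : ℤ_[p]) (hc : IsUnit c)
    (hMT : ∀ n : ℕ, ∃ q r : IwasawaAlgebra p,
      ((mazurTateElement f p n).map (algebraMap ℚ ℚ_[p]) : PowerSeries ℚ_[p]) *
            iwasawaToPowerSeries p P -
          iwasawaToPowerSeries p (PowerSeries.C c) *
            (((mazurTateElement f' p n).map (algebraMap ℚ ℚ_[p]) : PowerSeries ℚ_[p]) *
              iwasawaToPowerSeries p P') =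
        iwasawaToPowerSeries p
          (toIwasawa p (cyclotomicOmega p n) * q + PowerSeries.C (p : ℤ_[p]) * r))
    (ε : ℤˣ) (L L' : IwasawaAlgebra p) (hL : IsSignedPAdicLFunction f p ε L)
    (hL' : IsSignedPAdicLFunction f' p ε L') (hLU : HasUnitContent L) : HasUnitContent L' := by
  obtain ⟨u, rfl⟩ := hc
  have hMT' := mazurTate_congr_swap f f' P P' u hMT
  exact (hasUnitContent_and_lam_add_eq_of_mazurTate_congr hp2 hgood' hap' hgood hap hf' hf hP' hP
    (Units.isUnit u⁻¹) hMT' ε hL' hL (mu_eq_zero_of_hasUnitContent hLU)).1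

/-- **Unit content of `L^ε_p` is an INVARIANT of the displayed congruence**, with the `λ`-identity: under
`hMT` (unit `c`, unit-content `P, P′`), for every sign `ε`, `HasUnitContent L ↔ HasUnitContent L′`, and when
either holds `λ(L) + λ(P) = λ(L′) + λ(P′)`. Both directions of part 1 §1. CONDITIONAL on `hMT`; nothing
asserted. [cite: GreenbergVatsal2000, p. 2–3, (1)–(2) and §3 Remark 3.4] [cite: Pollack2003, Prop. 6.18 and Cor. 5.11] -/
theorem hasUnitContent_iff_of_mazurTate_congr
    {W W' : WeierstrassCurve ℚ} [W.IsElliptic] [W.IsGloballyMinimal] [W'.IsElliptic] [W'.IsGloballyMinimal]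
    (hp2 : p ≠ 2) (hgood : W.HasGoodReductionAtPrime p) (hap : W.frobeniusTrace p = 0)
    (hgood' : W'.HasGoodReductionAtPrime p) (hap' : W'.frobeniusTrace p = 0)
    {N N' : ℕ} [NeZero N] [NeZero N'] {f : CuspForm (Gamma0 N) 2} {f' : CuspForm (Gamma0 N') 2}
    (hf : IsNewformOf W f) (hf' : IsNewformOf W' f')
    {P P' : IwasawaAlgebra p} (hP : HasUnitContent P) (hP' : HasUnitContent P')
    {c : ℤ_[p]} (hc : IsUnit c)
    (hMT : ∀ n : ℕ, ∃ q r : IwasawaAlgebra p,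
      ((mazurTateElement f p n).map (algebraMap ℚ ℚ_[p]) : PowerSeries ℚ_[p]) *
            iwasawaToPowerSeries p P -
          iwasawaToPowerSeries p (PowerSeries.C c) *
            (((mazurTateElement f' p n).map (algebraMap ℚ ℚ_[p]) : PowerSeries ℚ_[p]) *
              iwasawaToPowerSeries p P') =
        iwasawaToPowerSeries p
          (toIwasawa p (cyclotomicOmega p n) * q + PowerSeries.C (p : ℤ_[p]) * r))
    (ε : ℤˣ) {L L' : IwasawaAlgebra p} (hL : IsSignedPAdicLFunction f p ε L)
    (hL' : IsSignedPAdicLFunction f' p ε L') :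
    (HasUnitContent L ↔ HasUnitContent L') ∧
      (HasUnitContent L → lam L + lam P = lam L' + lam P') := by
  have hback : HasUnitContent L' → HasUnitContent L ∧ lam L + lam P = lam L' + lam P' := fun hL'U =>
    hasUnitContent_and_lam_add_eq_of_mazurTate_congr hp2 hgood hap hgood' hap' hf hf' hP hP' hc hMT ε hL
      hL' (mu_eq_zero_of_hasUnitContent hL'U)
  have hforth : HasUnitContent L → HasUnitContent L' := fun hLU =>
    hasUnitContent_of_mazurTate_congr_swap p W W' hp2 hgood hap hgood' hap' N N' f f' hf hf' P P' hP hP' c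
      hc hMT ε L L' hL hL' hLU
  exact ⟨⟨hforth, fun h => (hback h).1⟩, fun h => (hback (hforth h)).2⟩

/-- **The E-side rider transfers: `μ(L^ε_p(E′)) = 0` for the partner at the rider's sign.** With the
Greenberg–Vatsal multipliers `P, P′ = ∏_{S₀} 𝒫_ℓ` (`S₀ ∌ p`; unit content is the kernel theorem
`hasUnitContent_and_lam_eulerFactorProduct`), the displayed congruence `hMT` and unit content of ONE signed
`L₀ = L^{ε₀}_p(E)`: every `L′` with `IsSignedPAdicLFunction f′ p ε₀ L′` has `μ(L′) = 0` — exactly the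
hypothesis `hμ′` of part 2's road, at the sign `ε₀`. CONDITIONAL on `hMT`; nothing asserted.
[cite: GreenbergVatsal2000, §1 (8)–(9) and §2 Prop. (2.4) (p. 22)] [cite: Pollack2003, Prop. 6.18 and Cor. 5.11] -/
theorem mu_signed_eq_zero_of_oneSign_of_mazurTate_congr
    {W W' : WeierstrassCurve ℚ} [W.IsElliptic] [W.IsGloballyMinimal] [W'.IsElliptic] [W'.IsGloballyMinimal]
    (hp2 : p ≠ 2) (hgood : W.HasGoodReductionAtPrime p) (hap : W.frobeniusTrace p = 0)
    (hgood' : W'.HasGoodReductionAtPrime p) (hap' : W'.frobeniusTrace p = 0)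
    {N N' : ℕ} [NeZero N] [NeZero N'] {f : CuspForm (Gamma0 N) 2} {f' : CuspForm (Gamma0 N') 2}
    (hf : IsNewformOf W f) (hf' : IsNewformOf W' f')
    (S₀ : Finset (HeightOneSpectrum (𝓞 ℚ))) (hS₀ : ∀ v ∈ S₀, ((p : ℕ) : 𝓞 ℚ) ∉ v.asIdeal)
    {c : ℤ_[p]} (hc : IsUnit c)
    (hMT : ∀ n : ℕ, ∃ q r : IwasawaAlgebra p,
      ((mazurTateElement f p n).map (algebraMap ℚ ℚ_[p]) : PowerSeries ℚ_[p]) *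
            iwasawaToPowerSeries p (eulerFactorProduct W p S₀) -
          iwasawaToPowerSeries p (PowerSeries.C c) *
            (((mazurTateElement f' p n).map (algebraMap ℚ ℚ_[p]) : PowerSeries ℚ_[p]) *
              iwasawaToPowerSeries p (eulerFactorProduct W' p S₀)) =
        iwasawaToPowerSeries p
          (toIwasawa p (cyclotomicOmega p n) * q + PowerSeries.C (p : ℤ_[p]) * r))
    {ε₀ : ℤˣ} {L₀ : IwasawaAlgebra p} (hL₀ : IsSignedPAdicLFunction f p ε₀ L₀) (hL₀U : HasUnitContent L₀) :
    ∀ L' : IwasawaAlgebra p, IsSignedPAdicLFunction f' p ε₀ L' → mu L' = 0 := by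
  intro L' hL'
  have hP := (hasUnitContent_and_lam_eulerFactorProduct W hp2 S₀ hS₀).1
  have hP' := (hasUnitContent_and_lam_eulerFactorProduct W' hp2 S₀ hS₀).1
  exact mu_eq_zero_of_hasUnitContent
    (hasUnitContent_of_mazurTate_congr_swap p W W' hp2 hgood hap hgood' hap' N N' f f' hf hf' _ _ hP hP' c
      hc hMT ε₀ L₀ L' hL₀ hL' hL₀U)

/-! ### §3 The one-sign CM road: the crux's conclusion shape with NO partner-side `μ` hypothesis -/

/-- **One-sign road, general partner: Kobayashi's main conjecture for `(E, p, ε₀)` AT THE RIDER'S SIGN from a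
congruent partner's main conjecture at `ε₀` — the partner's `μ = 0` SUPPLIED by the E-side rider.** Part 2's
`kobayashiMainConjecture_of_mazurTate_congr_of_mainConjecture` with `hμ′` discharged by
`mu_signed_eq_zero_of_oneSign_of_mazurTate_congr`. Inputs BY NAME (`h12`, `h41` rational, `h5`, `h3`, `h09`,
`hKim`, `hmod`); per datum: `p` odd, `E = W`, `E′ = W′` good at `p` with `a_p = 0`, `W[p] ≃ W′[p]` (`he`),
conductor-level newforms, `S₀ ∌ p` containing the bad places of both, unit `c`, `hMT`; the E-side rider
`IsSignedPAdicLFunction f₀ p ε₀ L₀ ∧ HasUnitContent L₀`; partner hypothesis `KobayashiMainConjecture W′ p ε₀`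
ONLY. PER PAIR; CONDITIONAL on `hMT`; NOT a class theorem about the crux; closes nothing.
[cite: GreenbergVatsal2000, Thm. (1.4), §1 (8)–(9) and §3 Remark 3.4] [cite: Kobayashi2003, Thm. 1.2, Thm. 4.1 (p. 8) and Conjecture (p. 2)]
[cite: BDKim2009, Cor. 2.13, Cor. 2.5 and Prop. 2.6 (pp. 185–187)] -/
theorem kobayashiMainConjecture_of_oneSign_of_mazurTate_congr_of_mainConjecture
    {W : WeierstrassCurve ℚ} [W.IsElliptic] [W.IsGloballyMinimal]
    (h12 : Kobayashi2003.thm12_signedSelmerDual_finite_torsion)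
    (h41 : Kobayashi2003.thm41_signedCharIdeal_divisibility)
    (h5 : realPeriodRat_eq_unit_mul_plusPeriod) (h3 : realPeriodRat_eq_unit_mul_plusPeriod_three)
    (h09 : cor213_signedMu_eq_zero_iff_of_torsionIso)
    (hKim : BDKim2009.cor213_signedLambda_add_sum_delta_eq_of_torsionIso)
    (hmod : nonempty_modularParametrizationData)
    (hp2 : p ≠ 2) (hgood : W.HasGoodReductionAtPrime p) (hap : W.frobeniusTrace p = 0)
    [NeZero (W.conductorNorm ℤ)] {f₀ : CuspForm (Gamma0 (W.conductorNorm ℤ)) 2} (hf₀ : IsNewformOf W f₀)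
    {ε₀ : ℤˣ} {L₀ : IwasawaAlgebra p} (hL₀ : IsSignedPAdicLFunction f₀ p ε₀ L₀) (hL₀U : HasUnitContent L₀)
    {W' : WeierstrassCurve ℚ} [W'.IsElliptic] [W'.IsGloballyMinimal]
    (hgood' : W'.HasGoodReductionAtPrime p) (hap' : W'.frobeniusTrace p = 0)
    (he : ∃ e : geomTorsion W (p : ℤ) ≃+ geomTorsion W' (p : ℤ),
      ∀ (σ : Field.absoluteGaloisGroup ℚ) (P : geomTorsion W (p : ℤ)), e (σ • P) = σ • e P)
    [NeZero (W'.conductorNorm ℤ)] {f₀' : CuspForm (Gamma0 (W'.conductorNorm ℤ)) 2}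
    (hf₀' : IsNewformOf W' f₀') (hMC' : KobayashiMainConjecture W' p ε₀)
    (S₀ : Finset (HeightOneSpectrum (𝓞 ℚ))) (hS₀ : ∀ v ∈ S₀, ((p : ℕ) : 𝓞 ℚ) ∉ v.asIdeal)
    (hS₀W : ∀ v : HeightOneSpectrum (𝓞 ℚ), ¬ W.HasGoodReductionAt v → v ∈ S₀)
    (hS₀W' : ∀ v : HeightOneSpectrum (𝓞 ℚ), ¬ W'.HasGoodReductionAt v → v ∈ S₀)
    {c : ℤ_[p]} (hc : IsUnit c)
    (hMT : ∀ n : ℕ, ∃ q r : IwasawaAlgebra p,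
      ((mazurTateElement f₀ p n).map (algebraMap ℚ ℚ_[p]) : PowerSeries ℚ_[p]) *
            iwasawaToPowerSeries p (eulerFactorProduct W p S₀) -
          iwasawaToPowerSeries p (PowerSeries.C c) *
            (((mazurTateElement f₀' p n).map (algebraMap ℚ ℚ_[p]) : PowerSeries ℚ_[p]) *
              iwasawaToPowerSeries p (eulerFactorProduct W' p S₀)) =
        iwasawaToPowerSeries p
          (toIwasawa p (cyclotomicOmega p n) * q + PowerSeries.C (p : ℤ_[p]) * r)) :
    KobayashiMainConjecture W p ε₀ :=
  kobayashiMainConjecture_of_mazurTate_congr_of_mainConjecture h12 h41 h5 h3 h09 hKim hmod hp2 hgood hap ε₀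
    hf₀ hgood' hap' he hf₀' hMC'
    (mu_signed_eq_zero_of_oneSign_of_mazurTate_congr hp2 hgood hap hgood' hap' hf₀ hf₀' S₀ hS₀ hc hMT hL₀ hL₀U)
    S₀ hS₀ hS₀W hS₀W' hc hMT

/-- **One-sign CM road at the rider's sign.** As above with a CM partner `E′ = W′` (good supersingular at the
odd `p`, `a_p(E′) = 0`), whose main conjecture is Pollack–Rubin 2004 BY NAME (`hPR`, via
`kobayashiMainConjecture_of_pollackRubin_of_goodSS`): `KobayashiMainConjecture W p ε₀` from the E-side rider
at `ε₀`, the partner data, `S₀`, `c`, `hMT` — NO partner-side `μ` hypothesis (part 2's `hμ′` and the L4-CM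
want W3 are struck for the rider's sign), NO Eisenstein engine for `E`, NO `Surj`, NO rank. PER PAIR;
CONDITIONAL on `hMT`; closes nothing. [cite: PollackRubin2004, Theorem (p. 448) = Thm. 7.3]
[cite: GreenbergVatsal2000, Thm. (1.4) and §3 Remark 3.4] [cite: Kobayashi2003, Thm. 4.1 (p. 8) and Conjecture (p. 2)]
[cite: BDKim2009, Cor. 2.13, Cor. 2.5 and Prop. 2.6 (pp. 185–187)] -/
theorem kobayashiMainConjecture_of_oneSign_of_mazurTate_congr_of_cmPartner
    {W : WeierstrassCurve ℚ} [W.IsElliptic] [W.IsGloballyMinimal]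
    (h12 : Kobayashi2003.thm12_signedSelmerDual_finite_torsion)
    (h41 : Kobayashi2003.thm41_signedCharIdeal_divisibility)
    (h5 : realPeriodRat_eq_unit_mul_plusPeriod) (h3 : realPeriodRat_eq_unit_mul_plusPeriod_three)
    (h09 : cor213_signedMu_eq_zero_iff_of_torsionIso)
    (hKim : BDKim2009.cor213_signedLambda_add_sum_delta_eq_of_torsionIso)
    (hPR : PollackRubin2004.mainTheorem_signedCharIdeal_eq_of_cm)
    (hmod : nonempty_modularParametrizationData)
    (hp2 : p ≠ 2) (hgood : W.HasGoodReductionAtPrime p) (hap : W.frobeniusTrace p = 0)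
    [NeZero (W.conductorNorm ℤ)] {f₀ : CuspForm (Gamma0 (W.conductorNorm ℤ)) 2} (hf₀ : IsNewformOf W f₀)
    {ε₀ : ℤˣ} {L₀ : IwasawaAlgebra p} (hL₀ : IsSignedPAdicLFunction f₀ p ε₀ L₀) (hL₀U : HasUnitContent L₀)
    {W' : WeierstrassCurve ℚ} [W'.IsElliptic] [W'.IsGloballyMinimal]
    (hcm' : W'.HasCM) (hss' : GoodSS W' p) (hap' : W'.frobeniusTrace p = 0)
    (he : ∃ e : geomTorsion W (p : ℤ) ≃+ geomTorsion W' (p : ℤ),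
      ∀ (σ : Field.absoluteGaloisGroup ℚ) (P : geomTorsion W (p : ℤ)), e (σ • P) = σ • e P)
    [NeZero (W'.conductorNorm ℤ)] {f₀' : CuspForm (Gamma0 (W'.conductorNorm ℤ)) 2}
    (hf₀' : IsNewformOf W' f₀')
    (S₀ : Finset (HeightOneSpectrum (𝓞 ℚ))) (hS₀ : ∀ v ∈ S₀, ((p : ℕ) : 𝓞 ℚ) ∉ v.asIdeal)
    (hS₀W : ∀ v : HeightOneSpectrum (𝓞 ℚ), ¬ W.HasGoodReductionAt v → v ∈ S₀)
    (hS₀W' : ∀ v : HeightOneSpectrum (𝓞 ℚ), ¬ W'.HasGoodReductionAt v → v ∈ S₀)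
    {c : ℤ_[p]} (hc : IsUnit c)
    (hMT : ∀ n : ℕ, ∃ q r : IwasawaAlgebra p,
      ((mazurTateElement f₀ p n).map (algebraMap ℚ ℚ_[p]) : PowerSeries ℚ_[p]) *
            iwasawaToPowerSeries p (eulerFactorProduct W p S₀) -
          iwasawaToPowerSeries p (PowerSeries.C c) *
            (((mazurTateElement f₀' p n).map (algebraMap ℚ ℚ_[p]) : PowerSeries ℚ_[p]) *
              iwasawaToPowerSeries p (eulerFactorProduct W' p S₀)) =
        iwasawaToPowerSeries p
          (toIwasawa p (cyclotomicOmega p n) * q + PowerSeries.C (p : ℤ_[p]) * r)) :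
    KobayashiMainConjecture W p ε₀ :=
  kobayashiMainConjecture_of_oneSign_of_mazurTate_congr_of_mainConjecture h12 h41 h5 h3 h09 hKim hmod hp2
    hgood hap hf₀ hL₀ hL₀U hss'.1 hap' he hf₀'
    (kobayashiMainConjecture_of_pollackRubin_of_goodSS W' p hPR hcm' hp2 hss' ε₀) S₀ hS₀ hS₀W hS₀W' hc hMT

/-- **ONE-SIGN CM ROAD = the card's `CmAnchorOneSign.OneSignCmRoad`, binders VERBATIM: the crux's conclusion
shape `∃ ε, KobayashiMainConjecture W p ε`** from the published inputs BY NAME, `p` odd good with `a_p(E) = 0`,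
the conductor-level newform `f₀`, the E-SIDE RIDER `∃ ε₀ L₀, IsSignedPAdicLFunction f₀ p ε₀ L₀ ∧ HasUnitContent L₀`,
a CM partner `W′` (`HasCM`, `GoodSS`, `a_p = 0`, `Γ_ℚ`-iso `W[p] ≃ W′[p]`), `f₀′`, a depletion set `S₀ ∌ p`
containing the bad places of both, a unit `c` and the displayed congruence `hMT`. The sign is the rider's
`ε₀` (`kobayashiMainConjecture_of_oneSign_of_mazurTate_congr_of_cmPartner`). NO Eisenstein engine for `E`
(`stub_lowerSmallImage` bypassed at the pair, not proved), NO partner-side `μ`, NO `Surj`, NO rank. PER PAIR;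
CONDITIONAL on `hMT` and the rider; NOT a class theorem about the crux; closes nothing.
[cite: PollackRubin2004, Theorem (p. 448) = Thm. 7.3] [cite: GreenbergVatsal2000, Thm. (1.4) and §3 Remark 3.4]
[cite: Kobayashi2003, Thm. 4.1 (p. 8) and Conjecture (p. 2)] [cite: BDKim2009, Cor. 2.13 (p. 187)] -/
theorem exists_kobayashiMainConjecture_of_oneSign_of_cmPartner
    (h12 : Kobayashi2003.thm12_signedSelmerDual_finite_torsion)
    (h41 : Kobayashi2003.thm41_signedCharIdeal_divisibility)
    (h5 : realPeriodRat_eq_unit_mul_plusPeriod) (h3 : realPeriodRat_eq_unit_mul_plusPeriod_three)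
    (h09 : cor213_signedMu_eq_zero_iff_of_torsionIso)
    (hKim : BDKim2009.cor213_signedLambda_add_sum_delta_eq_of_torsionIso)
    (hPR : PollackRubin2004.mainTheorem_signedCharIdeal_eq_of_cm)
    (hmod : nonempty_modularParametrizationData)
    (p : ℕ) [Fact p.Prime] (W : WeierstrassCurve ℚ) [W.IsElliptic] [W.IsGloballyMinimal]
    (hp2 : p ≠ 2) (hgood : W.HasGoodReductionAtPrime p) (hap : W.frobeniusTrace p = 0)
    [NeZero (W.conductorNorm ℤ)] (f₀ : CuspForm (Gamma0 (W.conductorNorm ℤ)) 2) (hf₀ : IsNewformOf W f₀)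
    (hrider : ∃ (ε₀ : ℤˣ) (L₀ : IwasawaAlgebra p), IsSignedPAdicLFunction f₀ p ε₀ L₀ ∧ HasUnitContent L₀)
    (W' : WeierstrassCurve ℚ) [W'.IsElliptic] [W'.IsGloballyMinimal]
    (hcm' : W'.HasCM) (hss' : GoodSS W' p) (hap' : W'.frobeniusTrace p = 0)
    (he : ∃ e : geomTorsion W (p : ℤ) ≃+ geomTorsion W' (p : ℤ),
      ∀ (σ : Field.absoluteGaloisGroup ℚ) (P : geomTorsion W (p : ℤ)), e (σ • P) = σ • e P)
    [NeZero (W'.conductorNorm ℤ)] (f₀' : CuspForm (Gamma0 (W'.conductorNorm ℤ)) 2)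
    (hf₀' : IsNewformOf W' f₀')
    (S₀ : Finset (HeightOneSpectrum (𝓞 ℚ))) (hS₀ : ∀ v ∈ S₀, ((p : ℕ) : 𝓞 ℚ) ∉ v.asIdeal)
    (hS₀W : ∀ v : HeightOneSpectrum (𝓞 ℚ), ¬ W.HasGoodReductionAt v → v ∈ S₀)
    (hS₀W' : ∀ v : HeightOneSpectrum (𝓞 ℚ), ¬ W'.HasGoodReductionAt v → v ∈ S₀)
    (c : ℤ_[p]) (hc : IsUnit c)
    (hMT : ∀ n : ℕ, ∃ q r : IwasawaAlgebra p,
      ((mazurTateElement f₀ p n).map (algebraMap ℚ ℚ_[p]) : PowerSeries ℚ_[p]) *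
            iwasawaToPowerSeries p (eulerFactorProduct W p S₀) -
          iwasawaToPowerSeries p (PowerSeries.C c) *
            (((mazurTateElement f₀' p n).map (algebraMap ℚ ℚ_[p]) : PowerSeries ℚ_[p]) *
              iwasawaToPowerSeries p (eulerFactorProduct W' p S₀)) =
        iwasawaToPowerSeries p
          (toIwasawa p (cyclotomicOmega p n) * q + PowerSeries.C (p : ℤ_[p]) * r)) :
    ∃ ε : ℤˣ, KobayashiMainConjecture W p ε := by
  obtain ⟨ε₀, L₀, hL₀, hL₀U⟩ := hrider
  exact ⟨ε₀, kobayashiMainConjecture_of_oneSign_of_mazurTate_congr_of_cmPartner h12 h41 h5 h3 h09 hKim hPR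
    hmod hp2 hgood hap hf₀ hL₀ hL₀U hcm' hss' hap' he hf₀' S₀ hS₀ hS₀W hS₀W' hc hMT⟩

end Summit.BirchSwinnertonDyer.BirchSwinnertonDyer.Theorems.SmallImageOneSignSwap

end
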